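import Literature.AnabelianGeometry.AbsoluteAnabelian.GaloisLevelRestriction
import Literature.AnabelianGeometry.AbsoluteAnabelian.AbsTopIII.ReconstructionCor110NatReciprocity
import Literature.NumberTheory.GaloisRepresentations.LocalReciprocityThetaUnique
import Literature.NumberTheory.GaloisRepresentations.LocalFieldFiniteExtensionIntegers
import Literature.AlgebraicGeometry.Frobenioids.PadicKummerThm24iiFieldIso
import HarnessLib

/-!
# Level packages along a finite extension: Serre's `θ` at a Galois level `L/F` and at its copy
# `ι(L)/E` agree along `ι` ([AbsAnab] Prop. 1.2.1 (vi)/(vii), «by considering the Verlagerung»)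

abc-iut cell, layer L4, row «COR110ib-OPEN» file F2 (abc-iut-L4-t11).  The canonical cyclotome
identifications `μ_{ℚ/ℤ}(G_k) ≅ μ(k̄)` of the tree (abc-iut-L6-t11's `exists_torsionReciprocityData_levelChar`,
the data used by the natural family of [AbsTopIII] Cor. 1.10 (i)(b), abc-iut-L4-d3) are pinned AT EVERY
REALISED FINITE LEVEL by a level package `(Art_M, θ_M)` characterised by Serre's reciprocity map of the
level field (`exists_levelReciprocity`).  To compare the data of `F` and of a finite extension `E` along
the restriction `res : G_E ↪ G_F`, one compares level packages at a Galois level `L ⊆ F̄` of `F` containing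
`E₀` and at its copy `M′ = ι(L) ⊆ Ē`, a level of `E`:

* **`level_package_transport`** — if `x` is the torsion class of `h ∈ Gal(F̄/L)` and `x′` that of
  `liftGal F E h ∈ Gal(Ē/M′)`, then `θ_{M′}(x′) = ι (θ_L(x))` in `Ē`, for ANY characterised packages
  `(Art_L, θ_L)` (base `F`) and `(Art_{M′}, θ_{M′})` (base `E`).

Proof: both packages are Serre's `θ` of the level field (`levelArt_eq_mk_iff_theta`), the level fields
are isomorphic (`σ : L ≅ M′` with lift `σ̄`, `Cor110Open.exists_levelFieldIso`), Serre's `θ` does not depend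
on the base (`LocalWeilDatum.theta_recSystemE_apply_eq_self`, uniqueness of `θ`) and is natural under the
field isomorphism `σ` (abc-iut-L4-d3's `Cor110Nat.canonicalTheta_unitsTransport` for `α = galConj σ σ̄`,
`ψ̄ = σ̄|units`, which is `α`-equivariant and uniformiser-preserving — abc-iut-L2-t12's
`isAlphaEquivariant_unitsMapEquiv` / `preservesUniformizers_unitsMapEquiv`, the latter through the
integrality transport `𝒪_L ↔ 𝒪_{M′}`), and `galConj σ σ̄` sends `liftGal F L h` to `liftGal E M′ (liftGal F E h)`.
Proof-only; universe `0`.  HONEST FRAMING: classical local class field theory; nothing here bears on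
[IUTchIII] Cor. 3.12.
-/

noncomputable section

open Field IntermediateField ValuativeRel
open scoped Pointwise

namespace Literature.AnabelianGeometry.AbsoluteAnabelian

open Literature.NumberTheory.GaloisRepresentations
open Literature.NumberTheory.GaloisRepresentations.LocalWeilDatum
open Literature.NumberTheory.GaloisRepresentations.IsNonarchimedeanLocalField
open Literature.AlgebraicGeometry.Frobenioids.PadicKummer

namespace Cor110Open

section Transport

variable (F E : Type) [Field F] [ValuativeRel F] [TopologicalSpace F] [IsNonarchimedeanLocalField F]
  [CharZero F] [Field E] [ValuativeRel E] [TopologicalSpace E] [IsNonarchimedeanLocalField E] [CharZero E]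
  [Algebra F E] [FiniteDimensional F E] [ValuativeExtension F E]
  (L : IntermediateField F (AlgebraicClosure F)) [FiniteDimensional F L] [IsGalois F L]
  (hEL : embField F E ≤ L)

-- The instance bookkeeping on the two level fields (`FiniteExtension` structures, `𝒪` of both, the
-- transported packages) pushes the single declaration past the default budget.
set_option maxHeartbeats 400000 in
/-- **Serre's `θ` at the level `L ⊆ F̄` (base `F`) and at its copy `ι(L) ⊆ Ē` (base `E`) agree along
`ι`.**  Let `(Art_L, θ_L)` be a package at the finite Galois level `L` of `F` and `(Art_{M′}, θ_{M′})` one at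
the level `M′ = ι(L)` of `E`, each CHARACTERISED by the finite abelian shadows of Serre's reciprocity map of
the level field (the clauses of `exists_levelReciprocity`: torsion in the range of `Art_L`, `hchar`,
and `θ x = u ↔ Art u = x`).  If `x` is the torsion class of `h ∈ Gal(F̄/L)` in `Gal(F̄/L)^ab` and `x′` the class
of `liftGal F E h ∈ Gal(Ē/M′)`, then `θ_{M′}(x′) = ι(θ_L(x))`.  ([AbsAnab] Prop. 1.2.1 (vi) for the
restriction `G_E ↪ G_F`: the LCFT identifications of the torsion are compatible with passing to a finite
extension.) [cite: MochizukiAbsAnab2004, Prop 1.2.1 (vi) p.10] -/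
theorem level_package_transport
    (ArtL : (embField F L)ˣ →* TopologicalAbelianization (galFixing F (embField F L)))
    (θL : abelianizationTorsion (galFixing F (embField F L)) →* (AlgebraicClosure F)ˣ)
    (htorsL : ∀ t, IsOfFinOrder t → t ∈ Set.range ArtL)
    (hcharL : ∀ (u : (embField F L)ˣ) (h : galFixing F (embField F L)),
      ArtL u = QuotientGroup.mk h ↔
        ∀ (L' : IntermediateField L (AlgebraicClosure L)) [FiniteDimensional L L'] [IsAbelianGalois L L'],
          AlgEquiv.restrictNormalHom L' (absoluteGaloisGroup.toAlgEquiv L (liftGal F L h.2)) =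
            recSystemE (isClassFieldTheory_localWeilDatum F) L'
              (Units.map ((equivEmbField F L).symm : embField F L →* L) u))
    (hθL : ∀ (x : abelianizationTorsion (galFixing F (embField F L))) (u : (embField F L)ˣ),
      ((θL x : (AlgebraicClosure F)ˣ) : AlgebraicClosure F) = ((u : embField F L) : AlgebraicClosure F) ↔
        ArtL u = x.1)
    [FiniteDimensional E (extField F E L hEL)]
    (ArtM : (embField E (extField F E L hEL))ˣ →*
      TopologicalAbelianization (galFixing E (embField E (extField F E L hEL))))
    (θM : abelianizationTorsion (galFixing E (embField E (extField F E L hEL))) →* (AlgebraicClosure E)ˣ)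
    (hcharM : ∀ (u : (embField E (extField F E L hEL))ˣ) (h : galFixing E (embField E (extField F E L hEL))),
      ArtM u = QuotientGroup.mk h ↔
        ∀ (L' : IntermediateField (extField F E L hEL) (AlgebraicClosure (extField F E L hEL)))
            [FiniteDimensional (extField F E L hEL) L'] [IsAbelianGalois (extField F E L hEL) L'],
          AlgEquiv.restrictNormalHom L'
              (absoluteGaloisGroup.toAlgEquiv (extField F E L hEL) (liftGal E (extField F E L hEL) h.2)) =
            recSystemE (isClassFieldTheory_localWeilDatum E) L'
              (Units.map ((equivEmbField E (extField F E L hEL)).symm :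
                embField E (extField F E L hEL) →* extField F E L hEL) u))
    (hθM : ∀ (x : abelianizationTorsion (galFixing E (embField E (extField F E L hEL))))
      (u : (embField E (extField F E L hEL))ˣ),
      ((θM x : (AlgebraicClosure E)ˣ) : AlgebraicClosure E) =
          ((u : embField E (extField F E L hEL)) : AlgebraicClosure E) ↔ ArtM u = x.1)
    (h : absoluteGaloisGroup F) (hhL : h ∈ galFixing F L) (hhL' : h ∈ galFixing F (embField F L))
    (x : abelianizationTorsion (galFixing F (embField F L)))
    (hx : (x : TopologicalAbelianization (galFixing F (embField F L))) = QuotientGroup.mk ⟨h, hhL'⟩)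
    (x' : abelianizationTorsion (galFixing E (embField E (extField F E L hEL))))
    (hx' : (x' : TopologicalAbelianization (galFixing E (embField E (extField F E L hEL)))) =
      QuotientGroup.mk ⟨liftGal F E (galFixing_level_le F E L hEL hhL),
        liftGal_mem_galFixing_embField_extField F E L hEL hhL⟩) :
    ((θM x' : (AlgebraicClosure E)ˣ) : AlgebraicClosure E) =
      absClosureEmbedding F E ((θL x : (AlgebraicClosure F)ˣ) : AlgebraicClosure F) := by
  classical
  -- local-field structures on the level fields (any choice would do; these make the base
  -- independence and the naturality of `θ` available)
  letI := FiniteExtension.normedField F L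
  letI := FiniteExtension.valuativeRel F L
  haveI : IsNonarchimedeanLocalField L := FiniteExtension.isNonarchimedeanLocalField F L
  haveI : ValuativeExtension F L := FiniteExtension.valuativeExtension F L
  haveI : ValuativeExtension L L := ⟨fun _ _ => Iff.rfl⟩
  letI := FiniteExtension.normedField E (extField F E L hEL)
  letI := FiniteExtension.valuativeRel E (extField F E L hEL)
  haveI : IsNonarchimedeanLocalField (extField F E L hEL) :=
    FiniteExtension.isNonarchimedeanLocalField E (extField F E L hEL)
  haveI : ValuativeExtension E (extField F E L hEL) := FiniteExtension.valuativeExtension E (extField F E L hEL)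
  haveI : ValuativeExtension (extField F E L hEL) (extField F E L hEL) := ⟨fun _ _ => Iff.rfl⟩
  haveI : CharZero L := charZero_of_injective_algebraMap (algebraMap F L).injective
  haveI : CharZero (extField F E L hEL) :=
    charZero_of_injective_algebraMap (algebraMap E (extField F E L hEL)).injective
  -- the level isomorphism
  obtain ⟨σ, σl, hσ, ha, hb, -⟩ := exists_levelFieldIso F E L hEL
  -- the `F`-side unit
  obtain ⟨uL, huL⟩ := htorsL x.1 ((CommGroup.mem_torsion _).mp x.2)
  have hθLx : ((θL x : (AlgebraicClosure F)ˣ) : AlgebraicClosure F) = ((uL : embField F L) : AlgebraicClosure F) :=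
    (hθL x uL).mpr huL
  -- the `E`-side unit `e′ (σ (e_L⁻¹ uL))`, of value `ι uL`
  set w : Lˣ := Units.map ((equivEmbField F L).symm : embField F L →* L) uL with hw
  set uM : (embField E (extField F E L hEL))ˣ :=
    Units.map (equivEmbField E (extField F E L hEL) : extField F E L hEL →* embField E (extField F E L hEL))
      (Units.map (σ : L →* extField F E L hEL) w) with huM
  have huMval : ((uM : embField E (extField F E L hEL)) : AlgebraicClosure E) =
      absClosureEmbedding F E ((uL : embField F L) : AlgebraicClosure F) := by
    rw [huM, Units.coe_map, MonoidHom.coe_coe, Units.coe_map, MonoidHom.coe_coe, ha, hw, Units.coe_map,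
      MonoidHom.coe_coe, AlgEquiv.apply_symm_apply]
  suffices hArtM : ArtM uM = x'.1 by
    rw [(hθM x' uM).mpr hArtM, huMval, hθLx]
  -- (ART): `Art_{M′} (ι u) = [liftGal F E h]`
  rw [hx']
  apply (levelArt_eq_mk_iff_theta hcharM uM _).mpr
  -- the `F`-side characterisation: `[liftGal F L h] = θ^{(F,L)} w`
  have hF : absGaloisAbProj L (liftGal F L hhL') =
      (isReciprocitySystemE (F := F) (E := L) (isClassFieldTheory_localWeilDatum F)).theta w :=
    (levelArt_eq_mk_iff_theta hcharL uL ⟨h, hhL'⟩).mp (huL.trans hx)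
  -- `e′⁻¹ uM = σ w`
  have huM' : Units.map ((equivEmbField E (extField F E L hEL)).symm :
      embField E (extField F E L hEL) →* extField F E L hEL) uM = Units.map (σ : L →* extField F E L hEL) w := by
    ext
    rw [huM, Units.coe_map, MonoidHom.coe_coe, Units.coe_map, MonoidHom.coe_coe, AlgEquiv.symm_apply_apply]
  rw [huM']
  -- integrality along `σ`, for the uniformiser clause
  have hO : ∀ y : L, y ∈ 𝒪[L] ↔ σ y ∈ 𝒪[extField F E L hEL] := by
    intro y
    refine (FiniteExtension.mem_integer_iff_isIntegral F L y).trans ?_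
    refine Iff.trans ?_ (FiniteExtension.mem_integer_iff_isIntegral E (extField F E L hEL) (σ y)).symm
    have e₁ : IsIntegral 𝒪[F] y ↔ ((y : L) : AlgebraicClosure F) ∈ absIntegers 𝒪[F] F := by
      rw [mem_integralClosure_iff]
      exact (isIntegral_algHom_iff (L.val.restrictScalars 𝒪[F]) (fun _ _ h => Subtype.ext h)).symm
    have e₂ : IsIntegral 𝒪[E] (σ y) ↔
        (((σ y : extField F E L hEL)) : AlgebraicClosure E) ∈ absIntegers 𝒪[E] E := by
      rw [mem_integralClosure_iff]
      exact (isIntegral_algHom_iff ((extField F E L hEL).val.restrictScalars 𝒪[E])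
        (fun _ _ h => Subtype.ext h)).symm
    have hmid : ((y : L) : AlgebraicClosure F) ∈ absIntegers 𝒪[F] F ↔
        (((σ y : extField F E L hEL)) : AlgebraicClosure E) ∈ absIntegers 𝒪[E] E := by
      rw [← mem_absIntegers_equivEmbField_iff F L y,
        ← mem_absIntegers_equivEmbField_iff E (extField F E L hEL) (σ y), ha,
        absClosureEmbedding_mem_absIntegers_iff]
    convert e₁.trans (hmid.trans e₂.symm) using 2
    · exact Algebra.algebra_ext _ _ fun r => rfl
    · exact Algebra.algebra_ext _ _ fun r => rfl
  -- naturality of Serre's `θ` under the field isomorphism `σ` (abc-iut-L4-d3), base independence (twice)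
  have hnat := Cor110Nat.canonicalTheta_unitsTransport (K₁ := L) (K₂ := extField F E L hEL)
    (galConjₜ σ σl hσ) (Def22Context.Iso.isAlphaEquivariant_unitsMapEquiv σ σl hσ)
    (Def22Context.Iso.preservesUniformizers_unitsMapEquiv σ σl hσ hO) w
    (Units.map (σ : L →* extField F E L hEL) w) (Def22Context.Iso.unitsMapEquiv_algebraMap σ σl hσ w)
  rw [LocalWeilDatum.theta_recSystemE_apply_eq_self (F := E) (E := extField F E L hEL), hnat,
    ← LocalWeilDatum.theta_recSystemE_apply_eq_self (F := F) (E := L), ← hF]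
  -- the Galois side: `α (liftGal F L h) = liftGal E M′ (liftGal F E h)`
  change absGaloisAbProj (extField F E L hEL) (liftGal E (extField F E L hEL)
      (liftGal_mem_galFixing_embField_extField F E L hEL hhL)) =
    abelianizationCongr (galConjₜ σ σl hσ) (QuotientGroup.mk (liftGal F L hhL'))
  rw [abelianizationCongr_mk, galConjₜ_apply, hb h hhL hhL']
  rfl

end Transport

end Cor110Open

end Literature.AnabelianGeometry.AbsoluteAnabelian
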